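import Summits.HodgeConjecture.HodgeConjecture.Theorems.K2E3CongruenceLayersGL   -- ★ p855410 (this seat): (H0)+(H1) layers — `coe_mul_sub_one`, `coe_conj_sub_one`, `valBound_coe_conj_sub_coe`; brings ★ `GLnCongruenceCommutators`, ★ `CongruenceSubgroupExpansionGL`, ★ `GLnCongruenceSubgroups`
import Mathlib.Algebra.Group.AddChar
import HarnessLib

/-!
# Crux `H413` — K2-LIT E3 «EllipticInputs», U12-h engine (H-char): THE CHARACTERS OF THE CONGRUENCE LAYERS OF `GL_n(F)` — `χ_X(k) = ψ(tr(X·(k − 1)))` is a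
# character of `K_γ` trivial on `K_δ` for `v(X)·γ² ≤ 1`, `v(X)·δ ≤ 1`; it depends on `X` only modulo `{v ≤ γ⁻¹}`, transforms under `GL_n(𝒪)` by the co-adjoint action
# `X ↦ κ⁻¹Xκ`, is `K_{γ'}`-conjugation invariant for `v(X)γ'γ ≤ 1`, and (for `ψ` of conductor exactly `𝒪`) `χ_X ≡ 1` on `K_m` iff `v(X) ≤ |ϖ|^{−m}`

Cell `hodgecm-mathlib`, Track B «K2-LIT», crux item `stmt-HodgeConjecture-24833` (h413), line `K2_E3_EllipticInputs`, unit U12 «HC characters», socket U12-h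
`sig_K2E3CharLocConstNearRegular` (‹#9L›): brick (H1) «characters of `K_ν` trivial on `K_{2ν}` ↔ cosets `X + L_ν^⊥`, `χ_X(1 + Y) = ψ(tr(XY))`» of Howe's Kirillov theory
for congruence subgroups at SPLIT places (K2E3-p09 memo v3 `K2/K2E3-p09/g0/MEMO-U12h-L5L6-statements.v3.K2E3-p09-g0.md` §2), offered BY NAME on the K2 bus
(2026-09-03T22:55Z) by seat K2E1b-p08 (g2) under K2E3-plan (g1)'s BATCH #3 free-hand rule; `--supports stmt-HodgeConjecture-24833 --as helper`.  THEOREMS ONLY — no `def`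
(the character `χ_X` is written INLINE as `ψ (Matrix.trace (X * ((k : Matrix (Fin n) (Fin n) F) - 1)))`), no named fact, no instance, no notation, no `sorry`.  GENERIC:
any field `F` with a `ValuativeRel`, any additive character `ψ : AddChar F M` into any commutative monoid `M` (Mathlib), the conductor hypotheses EXPLICIT
(`hψ : ∀ x, v x ≤ 1 → ψ x = 1` «trivial on `𝒪`»; `hψ' : ∃ x, v x ≤ |ϖ|⁻¹ ∧ ψ x ≠ 1` «non-trivial on `𝔭⁻¹`» only where needed) — so the file applies verbatim to
★ `TateLocalFactors`' `ψ : AddChar F Circle` with `AddChar.HasConductorExp ψ 0` once `primePowBall` is read through the valuation.  HONEST LABEL: HC_CM is proved only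
modulo the 7 printed citations (2 remaining named inputs: hLiu418 = stmt-HodgeConjecture-24832, h413 = stmt-HodgeConjecture-24833) until rung 0 closes; count-neutral
generic algebra.

THE MATHEMATICS [Howe1977Kirillov, §1; HarishChandra1999, §17 pp. 80–81 (Thm. 17.1 with `d(d)ξ_d(exp λ) = Σ ψ(B(X, λ))`); BushnellHenniart2006, §1.7 (level of `ψ`)].
With the trace form `B(X, Y) = tr(XY)` (under which `M_n(𝒪)` is self-dual for `ψ` of conductor `𝒪`: §1), the dual of the abelian layer `K_γ ⧸ K_δ ≅ {v ≤ γ} ⧸ {v ≤ δ}`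
(★ (H1) `K2E3CongruenceLayersGL`) is `{v ≤ δ⁻¹} ⧸ {v ≤ γ⁻¹}` via `X ↦ χ_X`, `χ_X(k) = ψ(tr(X(k − 1)))`:
* §1 `v(tr M) ≤ α` if `v(M) ≤ α` (ultrametric); `v(tr(XY)) ≤ v(X)·v(Y)`; hence **`ψ(tr(XY)) = 1` when `v(X)v(Y) ≤ 1`** (`ψ` trivial on `𝒪`).
* §2 **`χ_X` IS MULTIPLICATIVE on `K_γ·K_{γ'}` when `v(X)γγ' ≤ 1`** (`kk' − 1 = (k−1) + (k'−1) + (k−1)(k'−1)`, ★ `coe_mul_sub_one`, and the defect `tr(X(k−1)(k'−1)) ∈ 𝒪`),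
  `χ_X(1) = 1`, **TRIVIAL on `K_δ` when `v(X)δ ≤ 1`**, depends on `X` only modulo `{v ≤ γ⁻¹}` on `K_γ`; **EQUIVARIANCE** `χ_X(κkκ⁻¹) = χ_{κ⁻¹Xκ}(k)` (exact, trace cyclicity) and
  **`K_{γ'}`-INVARIANCE** `χ_X(κkκ⁻¹) = χ_X(k)` for `κ ∈ K_{γ'}`, `k ∈ K_γ`, `v(X)γ'γ ≤ 1` (★ `valBound_coe_conj_sub_coe`: `κkκ⁻¹ ≡ k` modulo `γ'γ`).
* §3 **NON-DEGENERACY** (uniformizer `ϖ`, `ψ` of conductor EXACTLY `𝒪`): `(∀ y ∈ 𝒪, ψ(ay) = 1) → a ∈ 𝒪` (`v(a) > 1 ⇒ v(a) ≥ |ϖ|⁻¹` in a DVR, ★ `IsUniformizingElement.exists_eq_mul`),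
  hence **`χ_X ≡ 1` on `K_m` ⟺ `v(X) ≤ |ϖ|^{−m}`** (test on the elementary layer elements `1 + ϖ^m y E_{ji}`, Mathlib `Matrix.trace_mul_single`), i.e. the parametrisation
  `X ↦ χ_X` of characters of `K_m ⧸ K_{2m}` by `ϖ^{−2m}M_n(𝒪)` has kernel exactly `ϖ^{−m}M_n(𝒪)`.  (Surjectivity onto ALL characters of `K_m ⧸ K_{2m}` — a counting ∕ perfect-
  pairing statement over the finite ring `𝒪 ⧸ ϖ^m` — is NOT claimed here.)

## References
* [Howe1977Kirillov] R. Howe, *Kirillov theory for compact p-adic groups*, Pacific J. Math. 73 (1977), 365–381, §1.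
* [HarishChandra1999] Harish-Chandra (DeBacker–Sally), *Admissible Invariant Distributions on Reductive p-adic Groups*, ULECT 16 (1999), §17 pp. 80–81.
* [BushnellHenniart2006] C. J. Bushnell, G. Henniart, *The Local Langlands Conjecture for GL(2)*, Grundlehren 335 (2006), §1.7 (level of an additive character), §1.1.
-/

set_option autoImplicit false
-- the mandated namespace repeats `HodgeConjecture.HodgeConjecture`, as in every `Theorems/*.lean` of this sub-problem
set_option linter.dupNamespace false

noncomputable section

open scoped MatrixGroups
open Matrix ValuativeRel Literature.NumberTheory.Automorphic

namespace Summit.HodgeConjecture.HodgeConjecture.Cruxes.H413.K2E3CongruenceLayerCharactersGL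

variable {F : Type*} [Field F] [ValuativeRel F] {n : ℕ} {M : Type*} [CommMonoid M] (ψ : AddChar F M)

/-! ## §1 The trace pairing and the valuation -/

section TracePairing

/-- `v(tr A) ≤ α` when every entry of `A` has `v ≤ α` (ultrametric inequality for the finite sum `Σ A_{ii}`). [cite: BushnellHenniart2006, §1.1] -/
theorem valuation_trace_le {α : ValueGroupWithZero F} {A : Matrix (Fin n) (Fin n) F} (hA : ValBound α A) : valuation F (Matrix.trace A) ≤ α :=
  Valuation.map_sum_le _ fun i _ => hA i i

/-- `v(tr(XY)) ≤ v(X)·v(Y)` entrywise: if `v(X) ≤ α` and `v(Y) ≤ β` then `v(tr(XY)) ≤ αβ` (★ `ValBound.mul`). [cite: BushnellHenniart2006, §1.1] -/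
theorem valuation_trace_mul_le {α β : ValueGroupWithZero F} {X Y : Matrix (Fin n) (Fin n) F} (hX : ValBound α X) (hY : ValBound β Y) :
    valuation F (Matrix.trace (X * Y)) ≤ α * β :=
  valuation_trace_le (hX.mul hY)

/-- **`ψ(tr(XY)) = 1` when `v(X)·v(Y) ≤ 1`** for `ψ` trivial on `𝒪`: the trace pairing takes `{v ≤ α} × {v ≤ β}` into `𝒪` when `αβ ≤ 1` — the self-duality of `M_n(𝒪)` in the
direction used by the orbit method. [cite: Howe1977Kirillov, §1] [cite: HarishChandra1999, §17 p. 80] -/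
theorem map_trace_mul_eq_one (hψ : ∀ x : F, valuation F x ≤ 1 → ψ x = 1) {α β : ValueGroupWithZero F} (hαβ : α * β ≤ 1) {X Y : Matrix (Fin n) (Fin n) F}
    (hX : ValBound α X) (hY : ValBound β Y) : ψ (Matrix.trace (X * Y)) = 1 :=
  hψ _ ((valuation_trace_mul_le hX hY).trans hαβ)

end TracePairing

/-! ## §2 `χ_X(k) = ψ(tr(X(k − 1)))` on the congruence subgroups: multiplicative, trivial on deep levels, equivariant -/

section Character

omit [ValuativeRel F] in
/-- `χ_X(1) = ψ(0) = 1`. [cite: Howe1977Kirillov, §1] -/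
theorem map_trace_mul_coe_one_sub_one (X : Matrix (Fin n) (Fin n) F) :
    ψ (Matrix.trace (X * (((1 : GL (Fin n) F) : Matrix (Fin n) (Fin n) F) - 1))) = 1 := by
  rw [Units.val_one, sub_self, Matrix.mul_zero, Matrix.trace_zero, AddChar.map_zero_eq_one]

/-- **MULTIPLICATIVITY `χ_X(kk') = χ_X(k)·χ_X(k')`** for `k ∈ K_γ`, `k' ∈ K_{γ'}` and `v(X) ≤ ξ` with `ξγγ' ≤ 1` (`ψ` trivial on `𝒪`): `kk' − 1 = (k−1) + (k'−1) + (k−1)(k'−1)` (★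
`coe_mul_sub_one`) and the defect `ψ(tr(X(k−1)(k'−1))) = 1` by §1.  With `γ = γ' = |ϖ|^m`, `ξ = |ϖ|^{−2m}`: `χ_X` is a character of `K_m`.
[cite: Howe1977Kirillov, §1] [cite: HarishChandra1999, §17 p. 80] -/
theorem map_trace_mul_coe_mul_sub_one (hψ : ∀ x : F, valuation F x ≤ 1 → ψ x = 1) {ξ γ γ' : ValueGroupWithZero F} (hξ : ξ * γ * γ' ≤ 1)
    {X : Matrix (Fin n) (Fin n) F} (hX : ValBound ξ X) {k k' : GL (Fin n) F} (hk : k ∈ congruenceGL n γ) (hk' : k' ∈ congruenceGL n γ') :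
    ψ (Matrix.trace (X * (((k * k' : GL (Fin n) F) : Matrix (Fin n) (Fin n) F) - 1))) =
      ψ (Matrix.trace (X * ((k : Matrix (Fin n) (Fin n) F) - 1))) * ψ (Matrix.trace (X * ((k' : Matrix (Fin n) (Fin n) F) - 1))) := by
  rw [K2E3CongruenceLayersGL.coe_mul_sub_one, Matrix.mul_add, Matrix.mul_add, Matrix.trace_add, Matrix.trace_add, AddChar.map_add_eq_mul, AddChar.map_add_eq_mul,
    ← Matrix.mul_assoc, map_trace_mul_eq_one ψ hψ hξ (hX.mul hk.2.1) hk'.2.1, mul_one]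

/-- **TRIVIALITY ON DEEP LEVELS: `χ_X(k) = 1` for `k ∈ K_δ` when `v(X) ≤ ξ`, `ξδ ≤ 1`** (§1).  With `δ = |ϖ|^{2m}`, `ξ = |ϖ|^{−2m}`: `χ_X` is trivial on `K_{2m}`, i.e. a character of
the layer `K_m ⧸ K_{2m}`. [cite: Howe1977Kirillov, §1] [cite: HarishChandra1999, §17 p. 80] -/
theorem map_trace_mul_coe_sub_one_eq_one (hψ : ∀ x : F, valuation F x ≤ 1 → ψ x = 1) {ξ δ : ValueGroupWithZero F} (hξ : ξ * δ ≤ 1)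
    {X : Matrix (Fin n) (Fin n) F} (hX : ValBound ξ X) {k : GL (Fin n) F} (hk : k ∈ congruenceGL n δ) :
    ψ (Matrix.trace (X * ((k : Matrix (Fin n) (Fin n) F) - 1))) = 1 :=
  map_trace_mul_eq_one ψ hψ hξ hX hk.2.1

/-- **`χ_X` DEPENDS ON `X` ONLY MODULO `{v ≤ γ⁻¹}` on `K_γ`**: if `v(X' − X) ≤ η` with `ηγ ≤ 1` then `χ_{X'}(k) = χ_X(k)` for `k ∈ K_γ` (`tr(X'(k−1)) = tr(X(k−1)) + tr((X'−X)(k−1))`).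
With `γ = |ϖ|^m`, `η = |ϖ|^{−m}`: the parametrisation `X ↦ χ_X` of characters of `K_m` factors through `X mod ϖ^{−m}M_n(𝒪)`. [cite: Howe1977Kirillov, §1] -/
theorem map_trace_mul_coe_sub_one_congr (hψ : ∀ x : F, valuation F x ≤ 1 → ψ x = 1) {η γ : ValueGroupWithZero F} (hη : η * γ ≤ 1)
    {X X' : Matrix (Fin n) (Fin n) F} (hXX' : ValBound η (X' - X)) {k : GL (Fin n) F} (hk : k ∈ congruenceGL n γ) :
    ψ (Matrix.trace (X' * ((k : Matrix (Fin n) (Fin n) F) - 1))) = ψ (Matrix.trace (X * ((k : Matrix (Fin n) (Fin n) F) - 1))) := by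
  have e : X' * ((k : Matrix (Fin n) (Fin n) F) - 1) = X * ((k : Matrix (Fin n) (Fin n) F) - 1) + (X' - X) * ((k : Matrix (Fin n) (Fin n) F) - 1) := by
    rw [Matrix.sub_mul, add_sub_cancel]
  rw [e, Matrix.trace_add, AddChar.map_add_eq_mul, map_trace_mul_eq_one ψ hψ hη hXX' hk.2.1, mul_one]

omit [ValuativeRel F] in
/-- **EQUIVARIANCE (exact): `χ_X(κkκ⁻¹) = χ_{κ⁻¹Xκ}(k)`** for all `κ, k ∈ GL_n(F)` — conjugation on the layer is the co-adjoint action `X ↦ κ⁻¹Xκ` on the parameters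
(★ `coe_conj_sub_one`: `κkκ⁻¹ − 1 = κ(k−1)κ⁻¹`; cyclicity of the trace). [cite: Howe1977Kirillov, §1] [cite: HarishChandra1999, §17 p. 81] -/
theorem map_trace_mul_coe_conj_sub_one (X : Matrix (Fin n) (Fin n) F) (κ k : GL (Fin n) F) :
    ψ (Matrix.trace (X * (((κ * k * κ⁻¹ : GL (Fin n) F) : Matrix (Fin n) (Fin n) F) - 1))) =
      ψ (Matrix.trace (((κ⁻¹ : GL (Fin n) F) : Matrix (Fin n) (Fin n) F) * X * (κ : Matrix (Fin n) (Fin n) F) * ((k : Matrix (Fin n) (Fin n) F) - 1))) := by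
  rw [K2E3CongruenceLayersGL.coe_conj_sub_one, ← Matrix.mul_assoc, ← Matrix.mul_assoc, Matrix.trace_mul_cycle, ← Matrix.mul_assoc]

/-- The co-adjoint parameter `κ⁻¹Xκ` has the same valuation bound as `X` for `κ ∈ GL_n(𝒪)`: `GL_n(𝒪)` acts on each parameter layer `{v ≤ δ⁻¹} ⧸ {v ≤ γ⁻¹}`. [cite: Howe1977Kirillov, §1] -/
theorem valBound_coe_inv_mul_mul_coe {ξ : ValueGroupWithZero F} {X : Matrix (Fin n) (Fin n) F} (hX : ValBound ξ X) {κ : GL (Fin n) F} (hκ : κ ∈ glInt n F) :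
    ValBound ξ (((κ⁻¹ : GL (Fin n) F) : Matrix (Fin n) (Fin n) F) * X * (κ : Matrix (Fin n) (Fin n) F)) := by
  have h := ((valBound_one_of_mem_glInt (Subgroup.inv_mem _ hκ)).mul hX).mul (valBound_one_of_mem_glInt hκ)
  rwa [one_mul, mul_one] at h

/-- **`K_{γ'}`-INVARIANCE: `χ_X(κkκ⁻¹) = χ_X(k)` for `κ ∈ K_{γ'}`, `k ∈ K_γ`, `v(X) ≤ ξ`, `ξγ'γ ≤ 1`** — by ★ `valBound_coe_conj_sub_coe` (`κkκ⁻¹ ≡ k` modulo `γ'γ`) and §1.  With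
`γ' = γ = |ϖ|^m`, `ξ = |ϖ|^{−2m}`: the characters `χ_X` of `K_m ⧸ K_{2m}` are `K_m`-conjugation invariant (the layer is central modulo `K_{2m}`); with `γ' = 1`: an
`X ∈ ϖ^{−m}M_n(𝒪)` gives a `GL_n(𝒪)`-invariant `χ_X` on `K_m` (indeed `χ_X ≡ 1` there, §2). [cite: Howe1977Kirillov, §1] [cite: HarishChandra1999, §17 p. 81] -/
theorem map_trace_mul_coe_conj_sub_one_eq (hψ : ∀ x : F, valuation F x ≤ 1 → ψ x = 1) {ξ γ γ' : ValueGroupWithZero F} (hξ : ξ * (γ' * γ) ≤ 1)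
    {X : Matrix (Fin n) (Fin n) F} (hX : ValBound ξ X) {κ k : GL (Fin n) F} (hκ : κ ∈ congruenceGL n γ') (hk : k ∈ congruenceGL n γ) :
    ψ (Matrix.trace (X * (((κ * k * κ⁻¹ : GL (Fin n) F) : Matrix (Fin n) (Fin n) F) - 1))) = ψ (Matrix.trace (X * ((k : Matrix (Fin n) (Fin n) F) - 1))) := by
  have e : X * (((κ * k * κ⁻¹ : GL (Fin n) F) : Matrix (Fin n) (Fin n) F) - 1) =
      X * ((k : Matrix (Fin n) (Fin n) F) - 1) + X * (((κ * k * κ⁻¹ : GL (Fin n) F) : Matrix (Fin n) (Fin n) F) - (k : Matrix (Fin n) (Fin n) F)) := by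
    rw [← Matrix.mul_add, sub_add_sub_cancel']
  rw [e, Matrix.trace_add, AddChar.map_add_eq_mul, map_trace_mul_eq_one ψ hψ hξ hX (K2E3CongruenceLayersGL.valBound_coe_conj_sub_coe hκ hk), mul_one]

end Character

/-! ## §3 Non-degeneracy for `ψ` of conductor exactly `𝒪`: `χ_X ≡ 1` on `K_m` iff `v(X) ≤ |ϖ|^{−m}` -/

section Conductor

variable {ϖ : F}

/-- In a discretely valued field with uniformizer `ϖ`: `v(a) > 1 ⇒ v(a) ≥ |ϖ|⁻¹` (`a⁻¹ ∈ 𝔪 = ϖ𝒪`, ★ `IsUniformizingElement.exists_eq_mul`). [cite: BushnellHenniart2006, §1.1] -/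
theorem inv_valuation_le_of_one_lt (hϖ : IsUniformizingElement ϖ) {a : F} (ha : 1 < valuation F a) : (valuation F ϖ)⁻¹ ≤ valuation F a := by
  have ha0 : a ≠ 0 := fun h => by rw [h, map_zero] at ha; exact not_lt_of_ge zero_le_one ha
  have hinv : valuation F a⁻¹ < 1 := by
    rw [map_inv₀]; exact inv_lt_one_of_one_lt₀ ha
  obtain ⟨y, hy, hay⟩ := hϖ.exists_eq_mul ((Valuation.mem_integer_iff _ _).2 hinv.le) hinv
  have hval : valuation F a⁻¹ ≤ valuation F ϖ := by
    rw [hay, map_mul]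
    calc valuation F ϖ * valuation F y ≤ valuation F ϖ * 1 := mul_le_mul_right ((Valuation.mem_integer_iff _ _).1 hy) _
      _ = valuation F ϖ := mul_one _
  rw [map_inv₀] at hval
  have hϖ0 : valuation F ϖ ≠ 0 := (Valuation.ne_zero_iff _).2 hϖ.ne_zero
  have hva0 : valuation F a ≠ 0 := (Valuation.ne_zero_iff _).2 ha0
  calc (valuation F ϖ)⁻¹ ≤ ((valuation F a)⁻¹)⁻¹ := inv_anti₀ (inv_pos.2 (zero_lt_iff.2 hva0)) hval
    _ = valuation F a := inv_inv _

/-- **`ψ` OF CONDUCTOR EXACTLY `𝒪` DETECTS INTEGRALITY: if `ψ(ay) = 1` for all `y ∈ 𝒪` then `a ∈ 𝒪`** (`ψ` non-trivial on `𝔭⁻¹ = {v ≤ |ϖ|⁻¹}`; were `v(a) > 1`, `a𝒪 ⊇ 𝔭⁻¹`).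
[cite: BushnellHenniart2006, §1.7] [cite: Howe1977Kirillov, §1] -/
theorem valuation_le_one_of_forall_map_mul_eq_one (hϖ : IsUniformizingElement ϖ) (hψ' : ∃ x : F, valuation F x ≤ (valuation F ϖ)⁻¹ ∧ ψ x ≠ 1) {a : F}
    (ha : ∀ y : F, valuation F y ≤ 1 → ψ (a * y) = 1) : valuation F a ≤ 1 := by
  by_contra hlt
  rw [not_le] at hlt
  obtain ⟨x, hx, hψx⟩ := hψ'
  have ha0 : a ≠ 0 := fun h => by rw [h, map_zero] at hlt; exact not_lt_of_ge zero_le_one hlt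
  have hva0 : valuation F a ≠ 0 := (Valuation.ne_zero_iff _).2 ha0
  have hle := inv_valuation_le_of_one_lt hϖ hlt
  have hy : valuation F (a⁻¹ * x) ≤ 1 := by
    rw [map_mul, map_inv₀]
    calc (valuation F a)⁻¹ * valuation F x ≤ (valuation F a)⁻¹ * (valuation F ϖ)⁻¹ := mul_le_mul_right hx _
      _ ≤ (valuation F a)⁻¹ * valuation F a := mul_le_mul_right hle _
      _ = 1 := inv_mul_cancel₀ hva0
  have h := ha _ hy
  rw [← mul_assoc, mul_inv_cancel₀ ha0, one_mul] at h
  exact hψx h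

/-- The elementary matrix `y • E_{ij}` with `y ∈ 𝒪` is integral. [folklore] -/
theorem isIntegralMatrix_single (i j : Fin n) {y : F} (hy : y ∈ 𝒪[F]) : IsIntegralMatrix (Matrix.single i j y) := by
  intro a b
  rw [Matrix.single_apply]
  split_ifs
  · exact hy
  · exact zero_mem _

omit [ValuativeRel F] in
/-- `tr(X · (y E_{ji})) = X_{ij}·y` (Mathlib `Matrix.trace_mul_single`), so `tr(X · ϖ^m y E_{ji}) = ϖ^m X_{ij} y`: the test of `χ_X` on the elementary layer elements.
[cite: Howe1977Kirillov, §1] -/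
theorem trace_mul_smul_single (X : Matrix (Fin n) (Fin n) F) (i j : Fin n) (m : ℕ) (y : F) :
    Matrix.trace (X * (ϖ ^ m • Matrix.single j i y)) = ϖ ^ m * X i j * y := by
  rw [Matrix.mul_smul, Matrix.trace_smul, Matrix.trace_mul_single, smul_eq_mul, MulOpposite.smul_eq_mul_unop, MulOpposite.unop_op, mul_assoc]

/-- **NON-DEGENERACY: if `χ_X ≡ 1` on `K_m` (`m ≥ 1`, `ψ` of conductor exactly `𝒪`) then `v(X) ≤ |ϖ|^{−m}`** — test on `k = 1 + ϖ^m y E_{ji} ∈ K_m` (`y ∈ 𝒪`; ★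
`mk''_one_add_smul_mem_congruenceGL`): `ψ(ϖ^m X_{ij} y) = 1` for all `y ∈ 𝒪` forces `ϖ^m X_{ij} ∈ 𝒪`.  So the kernel of `X ↦ χ_X|_{K_m}` on `{v ≤ |ϖ|^{−2m}}` is EXACTLY
`{v ≤ |ϖ|^{−m}} = ϖ^{−m}M_n(𝒪)`. [cite: Howe1977Kirillov, §1] [cite: HarishChandra1999, §17 Thm. 17.1] -/
theorem valBound_of_forall_map_trace_eq_one (hϖ : IsUniformizingElement ϖ) (hψ' : ∃ x : F, valuation F x ≤ (valuation F ϖ)⁻¹ ∧ ψ x ≠ 1) {m : ℕ} (hm : 1 ≤ m)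
    {X : Matrix (Fin n) (Fin n) F} (h : ∀ k ∈ congruenceGL n (valuation F ϖ ^ m), ψ (Matrix.trace (X * ((k : Matrix (Fin n) (Fin n) F) - 1))) = 1) :
    ValBound (valuation F ϖ ^ m)⁻¹ X := by
  intro i j
  have hv : 0 < valuation F ϖ ^ m := pow_pos ((Valuation.pos_iff _).mpr hϖ.ne_zero) _
  have key : valuation F (ϖ ^ m * X i j) ≤ 1 := by
    refine valuation_le_one_of_forall_map_mul_eq_one ψ hϖ hψ' fun y hy => ?_
    have hInt : IsIntegralMatrix (Matrix.single j i y) := isIntegralMatrix_single j i ((Valuation.mem_integer_iff _ _).2 hy)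
    have hk := h _ (mk''_one_add_smul_mem_congruenceGL hϖ hm hInt)
    rwa [show ((Matrix.GeneralLinearGroup.mk'' (1 + ϖ ^ m • Matrix.single j i y) (isUnit_det_one_add_smul hϖ hm hInt) : GL (Fin n) F) :
        Matrix (Fin n) (Fin n) F) = 1 + ϖ ^ m • Matrix.single j i y from rfl, add_sub_cancel_left, trace_mul_smul_single] at hk
  rw [map_mul, map_pow] at key
  rwa [← mul_le_mul_iff_right₀ hv, mul_inv_cancel₀ hv.ne']

/-- **`χ_X ≡ 1` ON `K_m` ⟺ `v(X) ≤ |ϖ|^{−m}`** (`m ≥ 1`, `ψ` of conductor exactly `𝒪`): (⇒) `valBound_of_forall_map_trace_eq_one`; (⇐) §2 triviality with `ξ = |ϖ|^{−m}`,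
`δ = |ϖ|^m`.  [cite: Howe1977Kirillov, §1] [cite: HarishChandra1999, §17 Thm. 17.1] -/
theorem forall_map_trace_eq_one_iff_valBound (hϖ : IsUniformizingElement ϖ) (hψ : ∀ x : F, valuation F x ≤ 1 → ψ x = 1)
    (hψ' : ∃ x : F, valuation F x ≤ (valuation F ϖ)⁻¹ ∧ ψ x ≠ 1) {m : ℕ} (hm : 1 ≤ m) (X : Matrix (Fin n) (Fin n) F) :
    (∀ k ∈ congruenceGL n (valuation F ϖ ^ m), ψ (Matrix.trace (X * ((k : Matrix (Fin n) (Fin n) F) - 1))) = 1) ↔ ValBound (valuation F ϖ ^ m)⁻¹ X := by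
  refine ⟨valBound_of_forall_map_trace_eq_one ψ hϖ hψ' hm, fun hX k hk => ?_⟩
  have hv : valuation F ϖ ^ m ≠ 0 := pow_ne_zero _ ((Valuation.ne_zero_iff _).2 hϖ.ne_zero)
  exact map_trace_mul_coe_sub_one_eq_one ψ hψ (le_of_eq (inv_mul_cancel₀ hv)) hX hk

/-- **TWO PARAMETERS GIVE THE SAME CHARACTER OF `K_m` IFF THEY AGREE MODULO `ϖ^{−m}M_n(𝒪)`** (`M` a commutative GROUP so that characters can be divided; `ψ` of conductor
exactly `𝒪`): `(∀ k ∈ K_m, χ_{X'}(k) = χ_X(k)) ↔ v(X' − X) ≤ |ϖ|^{−m}` — injectivity of `ϖ^{−2m}M_n(𝒪) ⧸ ϖ^{−m}M_n(𝒪) → (K_m ⧸ K_{2m})^∧`.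
[cite: Howe1977Kirillov, §1] [cite: HarishChandra1999, §17 Thm. 17.1] -/
theorem forall_map_trace_eq_iff_valBound_sub {M' : Type*} [CommGroup M'] (ψ' : AddChar F M') (hϖ : IsUniformizingElement ϖ)
    (hψ : ∀ x : F, valuation F x ≤ 1 → ψ' x = 1) (hψ' : ∃ x : F, valuation F x ≤ (valuation F ϖ)⁻¹ ∧ ψ' x ≠ 1) {m : ℕ} (hm : 1 ≤ m)
    (X X' : Matrix (Fin n) (Fin n) F) :
    (∀ k ∈ congruenceGL n (valuation F ϖ ^ m),
        ψ' (Matrix.trace (X' * ((k : Matrix (Fin n) (Fin n) F) - 1))) = ψ' (Matrix.trace (X * ((k : Matrix (Fin n) (Fin n) F) - 1)))) ↔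
      ValBound (valuation F ϖ ^ m)⁻¹ (X' - X) := by
  rw [← forall_map_trace_eq_one_iff_valBound ψ' hϖ hψ hψ' hm (X' - X)]
  refine forall_congr' fun k => forall_congr' fun _ => ?_
  rw [Matrix.sub_mul, Matrix.trace_sub, AddChar.map_sub_eq_div, div_eq_one]

end Conductor

end Summit.HodgeConjecture.HodgeConjecture.Cruxes.H413.K2E3CongruenceLayerCharactersGL

end
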